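import Literature.NumberTheory.Automorphic.BrandtMatrixThetaSeries
import Literature.NumberTheory.ModularForms.SiegelThetaMultiplierGaussSum
import Literature.NumberTheory.EllipticCurves.ModularFormsGamma0Genus
import Mathlib.NumberTheory.ModularForms.CuspFormSubmodule
import HarnessLib

/-!
# Stub-ideas k=1 · GEN 5 · `stub_xiDegreeComparison` (crux `SteinbergCore`, line `p6_tamagawa_split`)

Typed helper lemmas for the discharge of the ONE residual named fact of the lightest closing line (k2 G4),
`H1 : IsCuspForm (Θ_ij − Θ_kl)` for the Brandt theta series of an `XiSetup`, by RECOGNISE & IMPORT from the tree: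

* E1  cusp value of a theta series of even rank = Gauss sum (tree: `siegelThetaSeries_moeb_I_smul_eq_sum` +
      `tendsto_siegelJacobiTheta_zPrime`, A–Z Prop. 4.5 machinery, instantiated at `n = 1`, `M = γJ`, `d = |c|`);
* G1  ray limit ⇒ `valueAtInfty` of an `SL₂(ℤ)`-translate of a `Γ₀(N)`-form (tree: `tendsto_cosetSlash`);
* E2  Gauss sums are invariant under congruence-equivalence `Q' ≡ ᵗUQU (mod 2d)`, `U` invertible mod `d`;
* E4  the Gram matrices behind `Θ_ij`, `Θ_kl` are congruence-equivalent modulo every `2d` and have the same determinant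
      (locally principal right ideals + `nrd(O_pˣ) = ℤ_pˣ`);
* L1  a difference of two weight-2 `Γ₀(N)`-forms with the same value at every cusp is a cusp form
      (tree: `cuspFormOfVanishing`).

Evidence / plan only (sorried helpers); the composition `brandtTheta_sub_isCuspForm` is kernel-checked modulo the helpers.
-/

noncomputable section

open Complex hiding I
open Matrix Filter Topology ModularForm
open UpperHalfPlane hiding I
open Complex (I)
open scoped MatrixGroups

namespace Summit.ABC.ABC.Cruxes.SteinbergCore.StubIdeasK1G5

open Literature.NumberTheory.ModularForms
open Literature.NumberTheory.ModularForms.SiegelModularForm (one1)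
open Literature.NumberTheory.EllipticCurves.ModularForms
open Literature.NumberTheory.Automorphic Literature.NumberTheory.Automorphic.Brandt

/-! ## §0 Dictionary: the Gram matrix behind `Θ_ij` -/

variable {Nplus Nminus : ℕ} (S : XiSetup Nplus Nminus)

/-- The Gram matrix `[T_{ij}]` (even, symmetric, positive, `det = N²`) in the basis used to DEFINE `S.brandtTheta i j`. -/
def brandtGram (i j : ClassSet S.O) : Matrix (Fin 4) (Fin 4) ℤ :=
  normFormGram (S.nonempty_basis_transporterLeft i.rep_mem j.rep_mem).some (S.nrdGen j.rep_mem / S.nrdGen i.rep_mem)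

/-- `Θ_ij(τ) = θ¹((τ), [T_{ij}])` — definitional (`brandtTheta_def`, `normFormTheta_apply`). -/
theorem brandtTheta_apply (i j : ClassSet S.O) (τ : ℍ) :
    S.brandtTheta i j τ = siegelThetaSeries (brandtGram S i j) (one1 (τ : ℂ)) := rfl

/-- `det [T_{ij}] = (N⁺N⁻)²` (tree: `XiSetup.det_normFormGram` for the setup `S.ofLeftOrder i.rep_mem`). Size XS. -/
theorem det_brandtGram (i j : ClassSet S.O) : (brandtGram S i j).det = ((Nplus * Nminus : ℕ) : ℤ) ^ 2 :=
  (S.ofLeftOrder i.rep_mem).det_normFormGram (S.transporterLeft_mem_rightIdeals_leftOrder i.rep_mem j.rep_mem)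
    (div_pos (S.nrdGen_pos j.rep_mem) (S.nrdGen_pos i.rep_mem))
    (S.nrdIdeal_transporterLeft j.rep_mem i.rep_mem (S.nrdGen_pos j.rep_mem) (S.nrdGen_pos i.rep_mem)
      (S.nrdIdeal_eq_span_nrdGen j.rep_mem) (S.nrdIdeal_eq_span_nrdGen i.rep_mem))
    ((S.ofLeftOrder i.rep_mem).cast_normFormGram_mul (div_pos (S.nrdGen_pos j.rep_mem) (S.nrdGen_pos i.rep_mem)).ne'
      (S.nrdIdeal_transporterLeft j.rep_mem i.rep_mem (S.nrdGen_pos j.rep_mem) (S.nrdGen_pos i.rep_mem)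
        (S.nrdIdeal_eq_span_nrdGen j.rep_mem) (S.nrdIdeal_eq_span_nrdGen i.rep_mem)) _)

/-- `[T_{ij}]` is symmetric with even diagonal (tree: `isSymm_of_normFormGram`, `XiSetup.even_normFormGram_diag`). Size XS. -/
theorem isSymm_brandtGram (i j : ClassSet S.O) : (brandtGram S i j).IsSymm ∧ ∀ r, Even (brandtGram S i j r r) :=
  have hq := div_pos (S.nrdGen_pos j.rep_mem) (S.nrdGen_pos i.rep_mem)
  have hn := S.nrdIdeal_transporterLeft j.rep_mem i.rep_mem (S.nrdGen_pos j.rep_mem) (S.nrdGen_pos i.rep_mem)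
    (S.nrdIdeal_eq_span_nrdGen j.rep_mem) (S.nrdIdeal_eq_span_nrdGen i.rep_mem)
  have hA := (S.ofLeftOrder i.rep_mem).cast_normFormGram_mul hq.ne' hn
    (S.nonempty_basis_transporterLeft i.rep_mem j.rep_mem).some
  ⟨isSymm_of_normFormGram hq.ne' hA, fun r => (S.ofLeftOrder i.rep_mem).even_normFormGram_diag hq.ne' hn hA r⟩

/-! ## §1 (E1) The value of `θ_Q ∣_k γ` at `i∞` is a Gauss sum -/

/-- The cusp constant `v(θ_Q ∣_{m/2} γ)`: `d^{m/2}` at `c = 0` (then `d = ±1`), and for `c ≠ 0`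
`(√det Q)⁻¹ (ic)^{−m/2} |c|^m · G(a/c, Q)` with A–Z's Gauss sum `G(S, Q) = siegelGaussSum Q |c| S` ((4.10)). -/
def thetaCuspValue {m : ℕ} (Q : Matrix (Fin m) (Fin m) ℤ) (γ : SL(2, ℤ)) : ℂ :=
  if γ 1 0 = 0 then ((γ 1 1 : ℤ) : ℂ) ^ (m / 2)
  else ((Real.sqrt ((Q.det : ℤ) : ℝ) : ℝ) : ℂ)⁻¹ * (I * ((γ 1 0 : ℤ) : ℂ)) ^ (-((m / 2 : ℕ) : ℤ)) *
      (((γ 1 0).natAbs : ℕ) : ℂ) ^ m *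
        siegelGaussSum Q (γ 1 0).natAbs (one1 (((γ 0 0 : ℤ) : ℂ) / ((γ 1 0 : ℤ) : ℂ)))

/-- **E1 (tree corollary, size M).** For an even positive `Q ∈ A_m^+` of level `q` (`PQ = QP = q·1`, `m` even) and
`γ = (a b; c d) ∈ SL₂(ℤ)` with `c ≠ 0`: `(ciT + d)^{−m/2} θ_Q(γ(iT)) → thetaCuspValue Q γ` as `T → +∞`.
Proof: `γ(iT) = (γJ)⟨i/T⟩`, `J = (0 −1; 1 0)`; apply `siegelThetaSeries_moeb_I_smul_eq_sum` with `n = 1`, `M = γJ = (b −a; d −c)`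
(`D = −c`, `BD⁻¹ = a/c`, `d := |c|`, `T := one1 (a·sgn c)`), then `tendsto_siegelJacobiTheta_zPrime` for each of the `|c|^m`
theta factors and `siegelGaussSum_def`. -/
theorem tendsto_slash_siegelThetaSeries_ray {m : ℕ} (Q : Matrix (Fin m) (Fin m) ℤ) (hQ : Q.IsSymm) (hQe : ∀ i, Even (Q i i))
    (hQp : (Q.map ((↑) : ℤ → ℝ)).PosDef) (hm : Even m) {q : ℤ} (hq : 0 < q) {P : Matrix (Fin m) (Fin m) ℤ}
    (hPQ : P * Q = q • (1 : Matrix (Fin m) (Fin m) ℤ)) (hQP : Q * P = q • (1 : Matrix (Fin m) (Fin m) ℤ))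
    (γ : SL(2, ℤ)) (hc : γ 1 0 ≠ 0) :
    Tendsto (fun T : ℝ =>
        (((γ 1 0 : ℤ) : ℂ) * (I * (T : ℂ)) + ((γ 1 1 : ℤ) : ℂ)) ^ (-((m / 2 : ℕ) : ℤ)) *
          siegelThetaSeries Q (one1 ((((γ 0 0 : ℤ) : ℂ) * (I * (T : ℂ)) + ((γ 0 1 : ℤ) : ℂ)) /
            (((γ 1 0 : ℤ) : ℂ) * (I * (T : ℂ)) + ((γ 1 1 : ℤ) : ℂ)))))
      atTop (𝓝 (thetaCuspValue Q γ)) := by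
  sorry

/-- The ray `T ↦ i·max(T,1)` in `ℍ` (tends to `atImInfty`). -/
def rayI (T : ℝ) : ℍ := ⟨I * ((max T 1 : ℝ) : ℂ), by simp [Complex.mul_im]⟩

/-- **G1 (glue, size S).** For a `Γ₀(N)`-form `f` and `γ ∈ SL₂(ℤ)`, the translate `f ∣_k γ` tends to `valueAtInfty (f ∣_k γ)`
along `atImInfty` (tree: `tendsto_cosetSlash` via `cosetSlash_mk`), so a limit along the ray `i·T` IS that value. -/
theorem valueAtInfty_slash_eq_of_tendsto_ray {N : ℕ} [NeZero N] {k : ℤ} (f : ModularForm (CongruenceSubgroup.Gamma0 N) k)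
    (γ : SL(2, ℤ)) {v : ℂ} (h : Tendsto (fun T : ℝ => (⇑f ∣[k] (γ : GL (Fin 2) ℝ)) (rayI T)) atTop (𝓝 v)) :
    valueAtInfty (⇑f ∣[k] (γ : GL (Fin 2) ℝ)) = v := by
  have hF := slash_eq_of_mem_gamma0Space (coe_mem_formSpace f)
  have ht : Tendsto (⇑f ∣[k] (γ : GL (Fin 2) ℝ)) atImInfty (𝓝 (valueAtInfty (⇑f ∣[k] (γ : GL (Fin 2) ℝ)))) := by
    have := tendsto_cosetSlash (coe_mem_formSpace f) ((γ⁻¹ : SL(2, ℤ)) : SL(2, ℤ) ⧸ CongruenceSubgroup.Gamma0 N)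
    rwa [cosetSlash_mk hF, inv_inv] at this
  have hray : Tendsto rayI atTop atImInfty := by
    rw [atImInfty, Filter.tendsto_comap_iff]
    have hc : UpperHalfPlane.im ∘ rayI = fun T => max T 1 := by
      funext T
      show (I * ((max T 1 : ℝ) : ℂ)).im = max T 1
      simp
    rw [hc]
    exact Filter.tendsto_atTop_mono (fun T => le_max_left T 1) tendsto_id
  exact tendsto_nhds_unique (ht.comp hray) h

/-- **E1′ (Brandt corollary of E1 + G1, size S).** `v(Θ_ij ∣_2 γ) = thetaCuspValue [T_{ij}] γ` for every `γ ∈ SL₂(ℤ)`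
(`c = 0`: `Θ_ij(τ ± b) → a_0(Θ_ij) = 1`, `valueAtInfty_brandtTheta`; `c ≠ 0`: E1 with `m = 4`, `q = N⁺N⁻`, the level datum of
`exists_normFormGram_levelDatum`, and `SL_slash_apply`). -/
theorem valueAtInfty_slash_brandtTheta [NeZero (Nplus * Nminus)] (i j : ClassSet S.O) (γ : SL(2, ℤ)) :
    valueAtInfty (⇑(S.brandtTheta i j) ∣[(2 : ℤ)] (γ : GL (Fin 2) ℝ)) = thetaCuspValue (brandtGram S i j) γ := by
  sorry

/-! ## §2 (E2) Gauss sums only see `Q` modulo congruence-equivalence -/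

/-- **E2 (size S/M, finite sums).** If `Q' ≡ ᵗU Q U (mod 2d)` entrywise and `U` is invertible mod `d` (`UV ≡ 1`), then
`G(a/c, Q') = G(a/c, Q)` for `|c| = d` and every `a`: the phase `e{Q[L]·a/c} = e(aQ[L]/2c)` is a function of `L mod d`
(`siegelThetaSeriesTerm_add_smul`), `(Q' − ᵗUQU)[L] ∈ 2dℤ`, and `L ↦ UL` permutes `(ℤ/d)^m`. -/
theorem siegelGaussSum_congr_mod {m : ℕ} {Q Q' U V : Matrix (Fin m) (Fin m) ℤ} (hQ : Q.IsSymm) (hQe : ∀ i, Even (Q i i))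
    (hQ' : Q'.IsSymm) (hQ'e : ∀ i, Even (Q' i i)) {d : ℕ} (hd : 0 < d)
    (hUV : ∀ r s, (d : ℤ) ∣ (U * V - 1) r s) (hcong : ∀ r s, 2 * (d : ℤ) ∣ (Q' - Uᵀ * Q * U) r s)
    (a : ℤ) {c : ℤ} (hcd : c.natAbs = d) :
    siegelGaussSum Q' d (one1 ((a : ℂ) / (c : ℂ))) = siegelGaussSum Q d (one1 ((a : ℂ) / (c : ℂ))) := by
  sorry

/-! ## §3 (E4) The Brandt Gram matrices form one congruence class modulo every modulus -/

/-- **E4 (arithmetic input, size M).** For all classes `i j k l` and every `d > 0` the Gram matrices of `Θ_ij` and `Θ_kl` are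
congruence-equivalent mod `2d` by a matrix invertible mod `2d`.  Why true: the quadratic lattices `(I_jI_i⁻¹, nrd·q_i/q_j)` all lie
in the genus of `(O, nrd)` — locally `I_p = x O_p` (`QuaternionIdealLocallyPrincipal`), so `(I_jI_i⁻¹)_p = x_j O_p x_i⁻¹ ≅ (O_p, u·nrd)`
with `u ∈ ℤ_pˣ`, and `u = nrd(ε)`, `ε ∈ O_pˣ` (Eichler orders: `nrd(O_pˣ) = ℤ_pˣ`); a `ℤ_p`-isometry for each `p ∣ 2d`, reduced
mod `p^{v_p(2d)}` and glued by CRT, is the pair `(U, V)`. -/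
theorem brandtGram_congr_mod (i j k l : ClassSet S.O) {d : ℕ} (hd : 0 < d) :
    ∃ U V : Matrix (Fin 4) (Fin 4) ℤ, (∀ r s, (d : ℤ) ∣ (U * V - 1) r s) ∧
      ∀ r s, 2 * (d : ℤ) ∣ (brandtGram S k l - Uᵀ * brandtGram S i j * U) r s := by
  sorry

/-! ## §4 (L1) Equal cusp values ⇒ the difference is a cusp form -/

/-- **L1 (tree glue, size S).** Two weight-2 `Γ₀(N)`-forms whose `SL₂(ℤ)`-translates have the same value at `i∞` differ by a
cusp form: `⇑f − ⇑g ∈ gamma0Space N 2`, every translate of it is `IsZeroAtImInfty` (`tendsto_cosetSlash`, limits subtract),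
`cuspFormOfVanishing` builds the `CuspForm`, and `IsCuspForm` is membership in the range of `CuspForm.toModularFormₗ`. -/
theorem isCuspForm_sub_of_forall_valueAtInfty_slash_eq {N : ℕ} [NeZero N] (f g : ModularForm (CongruenceSubgroup.Gamma0 N) 2)
    (h : ∀ γ : SL(2, ℤ), valueAtInfty (⇑f ∣[(2 : ℤ)] (γ : GL (Fin 2) ℝ)) = valueAtInfty (⇑g ∣[(2 : ℤ)] (γ : GL (Fin 2) ℝ))) :
    ModularForm.IsCuspForm (f - g) := by
  have hF : (⇑f - ⇑g) ∈ gamma0Space N 2 := Submodule.sub_mem _ (coe_mem_formSpace f) (coe_mem_formSpace g)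
  have hlim : ∀ (u : ModularForm (CongruenceSubgroup.Gamma0 N) 2) (γ : SL(2, ℤ)),
      Tendsto (⇑u ∣[(2 : ℤ)] (γ : GL (Fin 2) ℝ)) atImInfty (𝓝 (valueAtInfty (⇑u ∣[(2 : ℤ)] (γ : GL (Fin 2) ℝ)))) := by
    intro u γ
    have := tendsto_cosetSlash (coe_mem_formSpace u) ((γ⁻¹ : SL(2, ℤ)) : SL(2, ℤ) ⧸ CongruenceSubgroup.Gamma0 N)
    rwa [cosetSlash_mk (slash_eq_of_mem_gamma0Space (coe_mem_formSpace u)), inv_inv] at this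
  have h0 : ∀ γ : SL(2, ℤ), IsZeroAtImInfty ((⇑f - ⇑g) ∣[(2 : ℤ)] (γ : GL (Fin 2) ℝ)) := by
    intro γ
    have hsub : (⇑f - ⇑g) ∣[(2 : ℤ)] (γ : GL (Fin 2) ℝ) =
        ⇑f ∣[(2 : ℤ)] (γ : GL (Fin 2) ℝ) - ⇑g ∣[(2 : ℤ)] (γ : GL (Fin 2) ℝ) := by
      rw [sub_eq_add_neg, SlashAction.add_slash, SlashAction.neg_slash, ← sub_eq_add_neg]
    show Tendsto ((⇑f - ⇑g) ∣[(2 : ℤ)] (γ : GL (Fin 2) ℝ)) atImInfty (𝓝 0)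
    rw [hsub]
    have := (hlim f γ).sub (hlim g γ)
    rwa [h γ, sub_self] at this
  refine ⟨cuspFormOfVanishing (⇑f - ⇑g) hF h0, ?_⟩
  ext τ
  rw [CuspForm.toModularFormₗ_apply, ModularForm.sub_apply]
  rfl

/-! ## §5 Composition: H1 of the k2 line -/

/-- **H1.** `Θ_ij − Θ_kl ∈ S_2(Γ_0(N⁺N⁻))` for all classes — from E1′ (both sides), E4 ⇒ E2 (equal Gauss sums at every cusp),
`det_brandtGram` (equal determinants) and L1. -/
theorem brandtTheta_sub_isCuspForm [NeZero (Nplus * Nminus)] (i j k l : ClassSet S.O) :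
    ModularForm.IsCuspForm (S.brandtTheta i j - S.brandtTheta k l) := by
  refine isCuspForm_sub_of_forall_valueAtInfty_slash_eq _ _ fun γ => ?_
  rw [valueAtInfty_slash_brandtTheta S i j γ, valueAtInfty_slash_brandtTheta S k l γ]
  unfold thetaCuspValue
  split_ifs with hc
  · rfl
  · have hd : 0 < (γ 1 0).natAbs := Int.natAbs_pos.mpr hc
    obtain ⟨U, V, hUV, hcong⟩ := brandtGram_congr_mod S i j k l hd
    rw [det_brandtGram S i j, det_brandtGram S k l,
      siegelGaussSum_congr_mod (isSymm_brandtGram S i j).1 (isSymm_brandtGram S i j).2 (isSymm_brandtGram S k l).1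
        (isSymm_brandtGram S k l).2 hd hUV hcong (γ 0 0) rfl]

end Summit.ABC.ABC.Cruxes.SteinbergCore.StubIdeasK1G5
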